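import Mathlib

/-!
# Tier 7 — LINE 3 support: lattice points in boxes and in the hyperbolic region `(1 + |x₁|)(1 + |x₂|) ≤ R`
(`Line3/LatticeCount.lean`; t7-L1-p5, gen 1; Mathlib only)

The `count_bound` of the version-(ii) isolation (t7-x1 l. 14901, proofs/t7/L3/X1-PRODUCT-FORMULA.md §2; p1's rows 659/670)
needs «#{lattice points of size ≤ R} ≲ R log R». With `size = |x|_{ι₂}·|x|_{ι₃}` that count is INFINITE (units; STATUS
l. 14914); with `size = (1 + |x|_{ι₂})(1 + |x|_{ι₃})` it is a theorem. This file proves the two generic lemmas: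
* `card_box_le`: for a ℤ-lattice `L = span ℤ (range b)` of `ι → ℝ` (`b` an ℝ-basis, sup norm) there is `C` with
  `#(L ∩ Icc (-r) r) ≤ C · ∏ i, (1 + r i)` for every box `Icc (-r) r`, `r ≥ 0` — the translates `l + F` of the
  fundamental domain `F = ZSpan.fundamentalDomain b` by the lattice points `l` of the box are pairwise disjoint
  (`ZSpan.exist_unique_vadd_mem_fundamentalDomain`), have volume `vol F = |det b| > 0` each, and lie in the box enlarged
  by `ρ = Σ ‖b j‖` (`ZSpan.norm_fract_le`), of volume `∏ (2 r i + 2ρ) ≤ (2 (1 + ρ))^{#ι} ∏ (1 + r i)`;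
* `card_hypRegion_le` (ι = `Fin 3`): `#{x ∈ L : |x 0| ≤ B ∧ (1 + |x 1|)(1 + |x 2|) ≤ R} ≤ C (1 + B) R (1 + log₂ R)`
  for `B ≥ 0`, `R ≥ 1` — dyadic slices `2^k ≤ 1 + |x 1| < 2^{k+1}`, `k ≤ log₂ ⌊R⌋₊` (`mem_dyadic_of_mem_hypRegion`),
  each a box of count `≤ 8 C (1 + B) R` (`card_dyadic_box_le`); and its `count_bound` shape `card_hypRegion_le_rpow`:
  for every `ε > 0`, `≤ C_ε (1 + B) (1 + R)^{1+ε}` (`log x ≤ x^ε / ε`).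
Nothing about the real objects: instantiating `L = M⁻¹O_F` at `(ι₁, ι₂, ι₃)` and `x = κ(γ) − κ(γ₀)` is the §2a dictionary.
CROSSED with t7-x1's `Line3/LatticeBoxCount.lean` (l. 14928, p667317: the box count by integer cells, no measure theory,
`ncard_box_le_real : #(box Λ R) ≤ #(unitBox Λ) · ∏ (2 R i + 3)` for any discrete `Λ`): §1 here is the INDEPENDENT
measure-theoretic proof of the box count (disjoint translates of the fundamental domain), kept because the dyadic step
consumes exactly its `∏ (1 + r i)` shape; the dyadic corollary §2 is the content x1 left to this seat.
Sorry-free; axioms: propext / Classical.choice / Quot.sound. §8(d): uses an L-value-free non-vanishing device: NO.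
-/

namespace Summit.Ventures.HodgeRepro2.Tier7.Line3.LatticeCount

open MeasureTheory Set
open scoped Pointwise

noncomputable section

variable {ι : Type} [Fintype ι]

/-- the ℤ-lattice spanned by the ℝ-basis `b` of `ι → ℝ` -/
abbrev lat (b : Module.Basis ι ℝ (ι → ℝ)) : Submodule ℤ (ι → ℝ) := Submodule.span ℤ (Set.range b)

/-- the radius of the fundamental domain: `‖f‖ ≤ Σ ‖b j‖` for `f ∈ ZSpan.fundamentalDomain b` -/
theorem norm_le_of_mem_fundamentalDomain (b : Module.Basis ι ℝ (ι → ℝ)) {f : ι → ℝ}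
    (hf : f ∈ ZSpan.fundamentalDomain b) : ‖f‖ ≤ ∑ j, ‖b j‖ := by
  rw [← ZSpan.fract_eq_self.mpr hf]
  exact ZSpan.norm_fract_le b f

/-- two translates of the fundamental domain by DISTINCT lattice points are disjoint -/
theorem disjoint_vadd_fundamentalDomain (b : Module.Basis ι ℝ (ι → ℝ)) {l l' : ι → ℝ} (hl : l ∈ lat b)
    (hl' : l' ∈ lat b) (hne : l ≠ l') :
    Disjoint (l +ᵥ ZSpan.fundamentalDomain b) (l' +ᵥ ZSpan.fundamentalDomain b) := by
  rw [Set.disjoint_left]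
  rintro x ⟨f, hf, rfl⟩ ⟨f', hf', hx⟩
  apply hne
  obtain ⟨v, _, huniq⟩ := ZSpan.exist_unique_vadd_mem_fundamentalDomain b f
  have hsub : l - l' ∈ lat b := Submodule.sub_mem _ hl hl'
  have hx' : l' + f' = l + f := hx
  have h1 : (⟨l - l', hsub⟩ : lat b) +ᵥ f ∈ ZSpan.fundamentalDomain b := by
    have h : (⟨l - l', hsub⟩ : lat b) +ᵥ f = f' := by
      change l - l' + f = f'
      calc l - l' + f = (l + f) - l' := by abel
        _ = (l' + f') - l' := by rw [hx']
        _ = f' := by abel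
    rw [h]
    exact hf'
  have h0 : (0 : lat b) +ᵥ f ∈ ZSpan.fundamentalDomain b := by
    rw [zero_vadd]
    exact hf
  have h2 : (⟨l - l', hsub⟩ : lat b) = 0 := (huniq _ h1).trans (huniq 0 h0).symm
  have h3 : l - l' = 0 := congrArg Subtype.val h2
  exact sub_eq_zero.mp h3

/-- a translate `l + F` with `l` in the box `Icc (-r) r` lies in the box enlarged by `ρ = Σ ‖b j‖` -/
theorem vadd_fundamentalDomain_subset (b : Module.Basis ι ℝ (ι → ℝ)) {r : ι → ℝ} {l : ι → ℝ}
    (hl : l ∈ Icc (-r) r) :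
    l +ᵥ ZSpan.fundamentalDomain b ⊆ Icc (fun i => -(r i + ∑ j, ‖b j‖)) (fun i => r i + ∑ j, ‖b j‖) := by
  rintro x ⟨f, hf, rfl⟩
  have hρ : ‖f‖ ≤ ∑ j, ‖b j‖ := norm_le_of_mem_fundamentalDomain b hf
  rw [Set.mem_Icc] at hl ⊢
  refine ⟨fun i => ?_, fun i => ?_⟩
  · have h1 : -r i ≤ l i := hl.1 i
    have h2 : |f i| ≤ ∑ j, ‖b j‖ := by
      rw [← Real.norm_eq_abs]
      exact (norm_le_pi_norm f i).trans hρ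
    have h3 : -(∑ j, ‖b j‖) ≤ f i := (abs_le.mp h2).1
    show -(r i + ∑ j, ‖b j‖) ≤ l i + f i
    linarith
  · have h1 : l i ≤ r i := hl.2 i
    have h2 : |f i| ≤ ∑ j, ‖b j‖ := by
      rw [← Real.norm_eq_abs]
      exact (norm_le_pi_norm f i).trans hρ
    have h3 : f i ≤ ∑ j, ‖b j‖ := (abs_le.mp h2).2
    show l i + f i ≤ r i + ∑ j, ‖b j‖
    linarith

/-- **lattice points in a box**: the finite set `L ∩ Icc (-r) r` has at most `vol(enlarged box) / vol(F)` points -/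
theorem card_mul_volume_le (b : Module.Basis ι ℝ (ι → ℝ)) (r : ι → ℝ) :
    ((Icc (-r) r ∩ (lat b : Set (ι → ℝ))).ncard : ENNReal) * volume (ZSpan.fundamentalDomain b) ≤
      ∏ i, ENNReal.ofReal (2 * r i + 2 * ∑ j, ‖b j‖) := by
  have hfin : (Icc (-r) r ∩ (lat b : Set (ι → ℝ))).Finite :=
    ZSpan.setFinite_inter b (Metric.isBounded_Icc (-r) r)
  set s : Finset (ι → ℝ) := hfin.toFinset with hs
  have hcard : (Icc (-r) r ∩ (lat b : Set (ι → ℝ))).ncard = s.card := by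
    rw [Set.ncard_eq_toFinset_card _ hfin]
  rw [hcard]
  -- the disjoint union of the translates
  have hmeas : ∀ l ∈ s, MeasurableSet (l +ᵥ ZSpan.fundamentalDomain b) := by
    intro l _
    exact (ZSpan.fundamentalDomain_measurableSet b).const_vadd l
  have hdisj : (s : Set (ι → ℝ)).PairwiseDisjoint (fun l => l +ᵥ ZSpan.fundamentalDomain b) := by
    intro l hl l' hl' hne
    have hl1 : l ∈ lat b := ((hfin.mem_toFinset).mp hl).2
    have hl'1 : l' ∈ lat b := ((hfin.mem_toFinset).mp hl').2
    exact disjoint_vadd_fundamentalDomain b hl1 hl'1 hne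
  have hunion : volume (⋃ l ∈ s, l +ᵥ ZSpan.fundamentalDomain b) =
      ∑ l ∈ s, volume (l +ᵥ ZSpan.fundamentalDomain b) := measure_biUnion_finset hdisj hmeas
  have hsum : ∑ l ∈ s, volume (l +ᵥ ZSpan.fundamentalDomain b) =
      (s.card : ENNReal) * volume (ZSpan.fundamentalDomain b) := by
    rw [Finset.sum_congr rfl (fun l _ => measure_vadd volume l (ZSpan.fundamentalDomain b)),
      Finset.sum_const, nsmul_eq_mul]
  have hsub : (⋃ l ∈ s, l +ᵥ ZSpan.fundamentalDomain b) ⊆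
      Icc (fun i => -(r i + ∑ j, ‖b j‖)) (fun i => r i + ∑ j, ‖b j‖) := by
    intro x hx
    rw [Set.mem_iUnion₂] at hx
    obtain ⟨l, hl, hxl⟩ := hx
    have hl1 : l ∈ Icc (-r) r := ((hfin.mem_toFinset).mp hl).1
    exact vadd_fundamentalDomain_subset b hl1 hxl
  have hvol : volume (Icc (fun i => -(r i + ∑ j, ‖b j‖)) (fun i => r i + ∑ j, ‖b j‖)) =
      ∏ i, ENNReal.ofReal (2 * r i + 2 * ∑ j, ‖b j‖) := by
    rw [Real.volume_Icc_pi]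
    refine Finset.prod_congr rfl fun i _ => ?_
    congr 1
    ring
  calc (s.card : ENNReal) * volume (ZSpan.fundamentalDomain b)
      = volume (⋃ l ∈ s, l +ᵥ ZSpan.fundamentalDomain b) := by rw [hunion, hsum]
    _ ≤ volume (Icc (fun i => -(r i + ∑ j, ‖b j‖)) (fun i => r i + ∑ j, ‖b j‖)) := measure_mono hsub
    _ = ∏ i, ENNReal.ofReal (2 * r i + 2 * ∑ j, ‖b j‖) := hvol

/-- **THE BOX COUNT**: `#(L ∩ Icc (-r) r) ≤ C · ∏ i, (1 + r i)` with `C = (2 (1 + ρ))^{#ι} / vol F` -/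
theorem card_box_le (b : Module.Basis ι ℝ (ι → ℝ)) :
    ∃ C : ℝ, 0 ≤ C ∧ ∀ r : ι → ℝ, (∀ i, 0 ≤ r i) →
      ((Icc (-r) r ∩ (lat b : Set (ι → ℝ))).ncard : ℝ) ≤ C * ∏ i, (1 + r i) := by
  set ρ : ℝ := ∑ j, ‖b j‖ with hρ
  have hρ0 : 0 ≤ ρ := Finset.sum_nonneg fun j _ => norm_nonneg _
  set V : ENNReal := volume (ZSpan.fundamentalDomain b) with hV
  have hV0 : V ≠ 0 := ZSpan.measure_fundamentalDomain_ne_zero b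
  have hVtop : V ≠ ⊤ := (ZSpan.fundamentalDomain_isBounded b).measure_lt_top.ne
  have hVpos : 0 < V.toReal := ENNReal.toReal_pos hV0 hVtop
  refine ⟨(2 * (1 + ρ)) ^ Fintype.card ι / V.toReal, by positivity, fun r hr => ?_⟩
  have h := card_mul_volume_le b r
  have hprod_ne_top : ∏ i, ENNReal.ofReal (2 * r i + 2 * ρ) ≠ ⊤ :=
    ENNReal.prod_ne_top fun i _ => ENNReal.ofReal_ne_top
  have h2 := ENNReal.toReal_mono hprod_ne_top h
  rw [ENNReal.toReal_mul, ENNReal.toReal_natCast, ENNReal.toReal_prod] at h2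
  have h3 : ∏ i, (ENNReal.ofReal (2 * r i + 2 * ρ)).toReal = ∏ i, (2 * r i + 2 * ρ) :=
    Finset.prod_congr rfl fun i _ => ENNReal.toReal_ofReal (by have := hr i; positivity)
  rw [h3] at h2
  have hbound : ∏ i, (2 * r i + 2 * ρ) ≤ (2 * (1 + ρ)) ^ Fintype.card ι * ∏ i, (1 + r i) := by
    have h4 : ∏ i, (2 * r i + 2 * ρ) ≤ ∏ i, (2 * (1 + ρ) * (1 + r i)) := by
      refine Finset.prod_le_prod (fun i _ => by have := hr i; positivity) fun i _ => ?_
      have := hr i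
      nlinarith
    rw [Finset.prod_mul_distrib, Finset.prod_const, Finset.card_univ] at h4
    exact h4
  rw [div_mul_eq_mul_div, le_div_iff₀ hVpos]
  exact h2.trans hbound

end

/-! ## 2. The hyperbolic region `(1 + |x 1|)(1 + |x 2|) ≤ R` in `Fin 3 → ℝ`: dyadic slices -/

section Hyperbolic

/-- the region: `|x 0| ≤ B` and `(1 + |x 1|)(1 + |x 2|) ≤ R`, intersected with the lattice -/
def hypRegion (b : Module.Basis (Fin 3) ℝ (Fin 3 → ℝ)) (B R : ℝ) : Set (Fin 3 → ℝ) :=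
  {x | x ∈ lat b ∧ |x 0| ≤ B ∧ (1 + |x 1|) * (1 + |x 2|) ≤ R}

/-- the `k`-th dyadic box: `|x 0| ≤ B`, `|x 1| ≤ 2^{k+1}`, `|x 2| ≤ R / 2^k` -/
noncomputable def dyadicRadius (B R : ℝ) (k : ℕ) : Fin 3 → ℝ := ![B, 2 ^ (k + 1), R / 2 ^ k]

/-- every point of the region lies in a dyadic box with `k ≤ log₂ ⌊R⌋₊` -/
theorem mem_dyadic_of_mem_hypRegion (b : Module.Basis (Fin 3) ℝ (Fin 3 → ℝ)) {B R : ℝ} (hR : 1 ≤ R)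
    {x : Fin 3 → ℝ} (hx : x ∈ hypRegion b B R) :
    ∃ k ∈ Finset.range (Nat.log 2 ⌊R⌋₊ + 1),
      x ∈ Icc (-dyadicRadius B R k) (dyadicRadius B R k) ∩ (lat b : Set (Fin 3 → ℝ)) := by
  obtain ⟨hxL, hx0, hx12⟩ := hx
  set t : ℝ := 1 + |x 1| with ht
  have ht1 : 1 ≤ t := by have := abs_nonneg (x 1); linarith
  have ht0 : 0 < t := by linarith
  have hs1 : 1 ≤ 1 + |x 2| := by have := abs_nonneg (x 2); linarith
  have htR : t ≤ R := by nlinarith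
  set n : ℕ := ⌊t⌋₊ with hn
  have hn1 : 1 ≤ n := Nat.le_floor (by simpa using ht1)
  have hn0 : n ≠ 0 := by omega
  set k : ℕ := Nat.log 2 n with hk
  have h2k : (2 : ℝ) ^ k ≤ t := by
    have h1 : 2 ^ k ≤ n := Nat.pow_log_le_self 2 hn0
    have h2 : (n : ℝ) ≤ t := Nat.floor_le ht0.le
    calc (2 : ℝ) ^ k = ((2 ^ k : ℕ) : ℝ) := by push_cast; ring
      _ ≤ (n : ℝ) := by exact_mod_cast h1
      _ ≤ t := h2
  have ht2k : t ≤ 2 ^ (k + 1) := by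
    have h1 : n < 2 ^ (k + 1) := Nat.lt_pow_succ_log_self (by norm_num) n
    have h2 : t < (n : ℝ) + 1 := Nat.lt_floor_add_one t
    have h3 : (n : ℝ) + 1 ≤ 2 ^ (k + 1) := by exact_mod_cast h1
    linarith
  have hkK : k ≤ Nat.log 2 ⌊R⌋₊ := Nat.log_mono_right (Nat.floor_mono htR)
  refine ⟨k, Finset.mem_range.mpr (by omega), ?_, hxL⟩
  rw [Set.mem_Icc]
  have h2kpos : (0 : ℝ) < 2 ^ k := by positivity
  have hx1 : |x 1| ≤ 2 ^ (k + 1) := by linarith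
  have hx2 : |x 2| ≤ R / 2 ^ k := by
    have h1 : 1 + |x 2| ≤ R / t := by
      rw [le_div_iff₀ ht0]
      linarith [mul_comm t (1 + |x 2|)]
    have h2 : R / t ≤ R / 2 ^ k := div_le_div_of_nonneg_left (by linarith) h2kpos h2k
    have := abs_nonneg (x 2)
    linarith
  have hd0 : dyadicRadius B R k 0 = B := rfl
  have hd1 : dyadicRadius B R k 1 = 2 ^ (k + 1) := rfl
  have hd2 : dyadicRadius B R k 2 = R / 2 ^ k := rfl
  refine ⟨fun i => ?_, fun i => ?_⟩
  · fin_cases i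
    · show -dyadicRadius B R k 0 ≤ x 0
      rw [hd0]
      exact (abs_le.mp hx0).1
    · show -dyadicRadius B R k 1 ≤ x 1
      rw [hd1]
      exact (abs_le.mp hx1).1
    · show -dyadicRadius B R k 2 ≤ x 2
      rw [hd2]
      exact (abs_le.mp hx2).1
  · fin_cases i
    · show x 0 ≤ dyadicRadius B R k 0
      rw [hd0]
      exact (abs_le.mp hx0).2
    · show x 1 ≤ dyadicRadius B R k 1
      rw [hd1]
      exact (abs_le.mp hx1).2
    · show x 2 ≤ dyadicRadius B R k 2
      rw [hd2]
      exact (abs_le.mp hx2).2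

/-- `2 ^ log₂ ⌊R⌋₊ ≤ R` for `R ≥ 1` -/
theorem two_pow_log_floor_le {R : ℝ} (hR : 1 ≤ R) : (2 : ℝ) ^ Nat.log 2 ⌊R⌋₊ ≤ R := by
  have h0 : ⌊R⌋₊ ≠ 0 := (Nat.floor_pos.mpr hR).ne'
  have h1 : 2 ^ Nat.log 2 ⌊R⌋₊ ≤ ⌊R⌋₊ := Nat.pow_log_le_self 2 h0
  have h2 : ((⌊R⌋₊ : ℕ) : ℝ) ≤ R := Nat.floor_le (by linarith)
  calc (2 : ℝ) ^ Nat.log 2 ⌊R⌋₊ = ((2 ^ Nat.log 2 ⌊R⌋₊ : ℕ) : ℝ) := by push_cast; ring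
    _ ≤ ((⌊R⌋₊ : ℕ) : ℝ) := by exact_mod_cast h1
    _ ≤ R := h2

/-- the count of one dyadic box: `≤ 8 C (1 + B) R` for `2^k ≤ R` -/
theorem card_dyadic_box_le (b : Module.Basis (Fin 3) ℝ (Fin 3 → ℝ)) {C : ℝ} (hC0 : 0 ≤ C)
    (hC : ∀ r : Fin 3 → ℝ, (∀ i, 0 ≤ r i) →
      ((Icc (-r) r ∩ (lat b : Set (Fin 3 → ℝ))).ncard : ℝ) ≤ C * ∏ i, (1 + r i))
    {B R : ℝ} (hB : 0 ≤ B) (hR : 1 ≤ R) {k : ℕ} (hk : (2 : ℝ) ^ k ≤ R) :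
    ((Icc (-dyadicRadius B R k) (dyadicRadius B R k) ∩ (lat b : Set (Fin 3 → ℝ))).ncard : ℝ) ≤
      8 * C * (1 + B) * R := by
  have h2kpos : (0 : ℝ) < 2 ^ k := by positivity
  have hr : ∀ i, 0 ≤ dyadicRadius B R k i := by
    intro i
    fin_cases i
    · show (0 : ℝ) ≤ B
      exact hB
    · show (0 : ℝ) ≤ 2 ^ (k + 1)
      positivity
    · show (0 : ℝ) ≤ R / 2 ^ k
      exact div_nonneg (by linarith) h2kpos.le
  refine (hC _ hr).trans ?_
  rw [Fin.prod_univ_three]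
  have hd0 : dyadicRadius B R k 0 = B := rfl
  have hd1 : dyadicRadius B R k 1 = 2 ^ (k + 1) := rfl
  have hd2 : dyadicRadius B R k 2 = R / 2 ^ k := rfl
  rw [hd0, hd1, hd2]
  have hA : (1 : ℝ) + 2 ^ (k + 1) ≤ 2 ^ (k + 2) := by
    have : (1 : ℝ) ≤ 2 ^ (k + 1) := one_le_pow₀ (by norm_num)
    rw [pow_succ 2 (k + 1)]
    linarith
  have hBx : 1 + R / 2 ^ k ≤ 2 * R / 2 ^ k := by
    have : 1 ≤ R / 2 ^ k := by
      rw [le_div_iff₀ h2kpos]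
      linarith
    rw [mul_div_assoc]
    linarith
  have hRk : (0 : ℝ) ≤ R / 2 ^ k := div_nonneg (by linarith) h2kpos.le
  have hprod : (1 + B) * (1 + 2 ^ (k + 1)) * (1 + R / 2 ^ k) ≤ 8 * (1 + B) * R := by
    have h2k0 : (2 : ℝ) ^ k ≠ 0 := h2kpos.ne'
    calc (1 + B) * (1 + 2 ^ (k + 1)) * (1 + R / 2 ^ k)
        ≤ (1 + B) * 2 ^ (k + 2) * (2 * R / 2 ^ k) :=
          mul_le_mul (mul_le_mul_of_nonneg_left hA (by linarith)) hBx (by linarith)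
            (mul_nonneg (by linarith) (by positivity))
      _ = 8 * (1 + B) * R := by
          field_simp
          ring
  calc C * ((1 + B) * (1 + 2 ^ (k + 1)) * (1 + R / 2 ^ k)) ≤ C * (8 * (1 + B) * R) :=
        mul_le_mul_of_nonneg_left hprod hC0
    _ = 8 * C * (1 + B) * R := by ring

/-- **THE HYPERBOLIC COUNT**: for a ℤ-lattice `L ⊂ ℝ³` there is `C` with
`#{x ∈ L : |x 0| ≤ B ∧ (1 + |x 1|)(1 + |x 2|) ≤ R} ≤ C (1 + B) R (1 + log₂ R)` for all `B ≥ 0`, `R ≥ 1`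
(the «R log R» count of the version-(ii) isolation, with the `(1 + ·)(1 + ·)` size) -/
theorem card_hypRegion_le (b : Module.Basis (Fin 3) ℝ (Fin 3 → ℝ)) :
    ∃ C : ℝ, 0 ≤ C ∧ ∀ B : ℝ, 0 ≤ B → ∀ R : ℝ, 1 ≤ R →
      ((hypRegion b B R).ncard : ℝ) ≤ C * (1 + B) * R * (1 + Real.logb 2 R) := by
  classical
  obtain ⟨C, hC0, hC⟩ := card_box_le b
  refine ⟨8 * C, by positivity, fun B hB R hR => ?_⟩
  set K : ℕ := Nat.log 2 ⌊R⌋₊ with hK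
  have hfin : ∀ k : ℕ,
      (Icc (-dyadicRadius B R k) (dyadicRadius B R k) ∩ (lat b : Set (Fin 3 → ℝ))).Finite :=
    fun k => ZSpan.setFinite_inter b (Metric.isBounded_Icc _ _)
  set T : Finset (Fin 3 → ℝ) := (Finset.range (K + 1)).biUnion (fun k => (hfin k).toFinset) with hT
  have hsub : hypRegion b B R ⊆ ↑T := by
    intro x hx
    obtain ⟨k, hk, hxk⟩ := mem_dyadic_of_mem_hypRegion b hR hx
    rw [hT, Finset.coe_biUnion, Set.mem_iUnion₂]
    exact ⟨k, hk, (hfin k).mem_toFinset.mpr hxk⟩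
  have h1 : (hypRegion b B R).ncard ≤ T.card := by
    have := Set.ncard_le_ncard hsub T.finite_toSet
    rwa [Set.ncard_coe_finset] at this
  have h2 : T.card ≤ ∑ k ∈ Finset.range (K + 1), (hfin k).toFinset.card := Finset.card_biUnion_le
  have h3 : ∀ k ∈ Finset.range (K + 1), ((hfin k).toFinset.card : ℝ) ≤ 8 * C * (1 + B) * R := by
    intro k hk
    have hk' : k ≤ K := Nat.lt_succ_iff.mp (Finset.mem_range.mp hk)
    have hcard : ((hfin k).toFinset.card : ℝ) =
        ((Icc (-dyadicRadius B R k) (dyadicRadius B R k) ∩ (lat b : Set (Fin 3 → ℝ))).ncard : ℝ) := by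
      rw [Set.ncard_eq_toFinset_card _ (hfin k)]
    rw [hcard]
    have h2k : (2 : ℝ) ^ k ≤ R :=
      (pow_le_pow_right₀ (by norm_num : (1 : ℝ) ≤ 2) hk').trans (two_pow_log_floor_le hR)
    exact card_dyadic_box_le b hC0 hC hB hR h2k
  have h4 : (∑ k ∈ Finset.range (K + 1), ((hfin k).toFinset.card : ℝ)) ≤
      ((K : ℝ) + 1) * (8 * C * (1 + B) * R) := by
    have := Finset.sum_le_sum h3
    rw [Finset.sum_const, Finset.card_range, nsmul_eq_mul] at this
    push_cast at this
    exact this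
  have hK1 : (K : ℝ) ≤ Real.logb 2 R := by
    rw [Real.le_logb_iff_rpow_le (by norm_num) (by linarith), Real.rpow_natCast]
    exact two_pow_log_floor_le hR
  have hpos : (0 : ℝ) ≤ 8 * C * (1 + B) * R :=
    mul_nonneg (mul_nonneg (by positivity) (by linarith)) (by linarith)
  calc ((hypRegion b B R).ncard : ℝ) ≤ (T.card : ℝ) := by exact_mod_cast h1
    _ ≤ ∑ k ∈ Finset.range (K + 1), ((hfin k).toFinset.card : ℝ) := by exact_mod_cast h2
    _ ≤ ((K : ℝ) + 1) * (8 * C * (1 + B) * R) := h4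
    _ ≤ (1 + Real.logb 2 R) * (8 * C * (1 + B) * R) :=
        mul_le_mul_of_nonneg_right (by linarith) hpos
    _ = 8 * C * (1 + B) * R * (1 + Real.logb 2 R) := by ring

/-- the `count_bound` SHAPE of p1's rows 659/670 (`≤ C′ (1 + R)^β` with `β = 1 + ε < 3/2`): for every `ε > 0`
there is `C_ε` with `#{x ∈ L : |x 0| ≤ B ∧ (1 + |x 1|)(1 + |x 2|) ≤ R} ≤ C_ε (1 + B) (1 + R)^{1+ε}` -/
theorem card_hypRegion_le_rpow (b : Module.Basis (Fin 3) ℝ (Fin 3 → ℝ)) {ε : ℝ} (hε : 0 < ε) :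
    ∃ C : ℝ, 0 ≤ C ∧ ∀ B : ℝ, 0 ≤ B → ∀ R : ℝ, 1 ≤ R →
      ((hypRegion b B R).ncard : ℝ) ≤ C * (1 + B) * (1 + R) ^ (1 + ε) := by
  obtain ⟨C, hC0, hC⟩ := card_hypRegion_le b
  have hlog2 : 0 < Real.log 2 := Real.log_pos (by norm_num)
  have hpos : 0 < ε * Real.log 2 := mul_pos hε hlog2
  refine ⟨C * (1 + 1 / (ε * Real.log 2)), by positivity, fun B hB R hR => ?_⟩
  have hR0 : 0 < R := by linarith
  have h1 : Real.logb 2 R ≤ R ^ ε / (ε * Real.log 2) := by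
    have h := Real.log_le_rpow_div hR0.le hε
    rw [le_div_iff₀ hε] at h
    rw [Real.logb, div_le_div_iff₀ hlog2 hpos]
    nlinarith [hlog2]
  have hRe : R ^ (1 + ε) ≤ (1 + R) ^ (1 + ε) := Real.rpow_le_rpow hR0.le (by linarith) (by linarith)
  have hR1 : R ≤ (1 + R) ^ (1 + ε) := by
    calc R = R ^ (1 : ℝ) := (Real.rpow_one R).symm
      _ ≤ R ^ (1 + ε) := Real.rpow_le_rpow_of_exponent_le hR (by linarith)
      _ ≤ (1 + R) ^ (1 + ε) := hRe
  have hmul : R * R ^ ε = R ^ (1 + ε) := by rw [Real.rpow_add hR0, Real.rpow_one]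
  have h2 : R * (1 + Real.logb 2 R) ≤ (1 + 1 / (ε * Real.log 2)) * (1 + R) ^ (1 + ε) := by
    calc R * (1 + Real.logb 2 R) ≤ R * (1 + R ^ ε / (ε * Real.log 2)) := by
          apply mul_le_mul_of_nonneg_left _ hR0.le
          linarith
      _ = R + R ^ (1 + ε) / (ε * Real.log 2) := by rw [mul_add, mul_one, mul_div_assoc', hmul]
      _ ≤ (1 + R) ^ (1 + ε) + (1 + R) ^ (1 + ε) / (ε * Real.log 2) :=
          add_le_add hR1 (div_le_div_of_nonneg_right hRe hpos.le)
      _ = (1 + 1 / (ε * Real.log 2)) * (1 + R) ^ (1 + ε) := by ring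
  calc ((hypRegion b B R).ncard : ℝ) ≤ C * (1 + B) * R * (1 + Real.logb 2 R) := hC B hB R hR
    _ = C * (1 + B) * (R * (1 + Real.logb 2 R)) := by ring
    _ ≤ C * (1 + B) * ((1 + 1 / (ε * Real.log 2)) * (1 + R) ^ (1 + ε)) :=
        mul_le_mul_of_nonneg_left h2 (mul_nonneg hC0 (by linarith))
    _ = C * (1 + 1 / (ε * Real.log 2)) * (1 + B) * (1 + R) ^ (1 + ε) := by ring

end Hyperbolic

end Summit.Ventures.HodgeRepro2.Tier7.Line3.LatticeCount
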